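import Summits.NavierStokesRegularity.NavierStokesRegularity.Theorems.GaldiLiouvilleGateAllAxesCorePackages
import HarnessLib

/-!
# Galdi's Liouville problem ⟨0895⟩, line «all-axes cylinder budget», piece O1c (5b/·):
# the ONE-STROKE cylinder inequality at fixed cut-offs `(ε, T, Z)`

Route `GaldiLiouvilleGate`, items ⟨0895⟩/⟨0896⟩; LINE allaxes/cylbudget, combined Defs v3.1
(817120c4c833a18a), obligation O1c′ `CylinderBookkeepingSplit` (BLUEPRINT §2–§3, Remark 15).  For a
classical steady pair `(U, P)` (`IsLerayProfile ν 0 U P`, smooth) with the head sign `P + |U|²/2 ≤ c`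
(O1b), the identity `∫ (P−c)Δψ + D²ψ(U,U) = 0` (piece 1) for the cylindrical test function
`ψ = χ_Z(x₂)·M(x₀²+x₁²)` (pieces 2–4) and the zone bounds of the density (piece 5a) give, for
`0 < ε ≤ t`, `T ≥ 2(t+ε)`, `Z ≥ 0`, `c₁ = (t+ε)²`, `s = x₀² + x₁²`, `Γ = x₀U₁ − x₁U₀`, and an ABSOLUTE `K`:

  `∫_{s ≤ t², |x₂| ≤ Z} u_z² ≤ K ∫_{t² < s ≤ c₁} (c−P) + c₁ ∫_{c₁ < s ≤ T²} Γ²/s² + K c₁ ∫_{T² < s ≤ 4T²} Γ²/s²`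
  `  + (K c₁/T²) ∫_{T² < s ≤ 4T²} (c−P) + K (T²+T) ∫_{s ≤ 4T², |x₂| ≥ Z} (c−P)`   (`core_axialEnergy_bound`, in `ℝ≥0∞`).

No decay of `U`, `P` and no symmetry is used here; the three cut-offs are removed in piece 5c.
[folklore; cite: KorobkovPileckasRusso2015 (Wang monograph Thm 3.5–3.6, the cylinder identities)]
No summit / no ⟨0895⟩–⟨0896⟩ claim is proved here; NS regularity is not touched.
-/

noncomputable section

-- the problem directory repeats the summit name (D-0017); core's `dupNamespace` linter fires
set_option linter.dupNamespace false

open MeasureTheory Set Filter Topology InnerProductSpace Function Metric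
open scoped RealInnerProductSpace Laplacian Topology ENNReal

namespace Summit.NavierStokesRegularity.NavierStokesRegularity.Theorems.GaldiLiouville.AllAxesBudget

open Literature.Analysis.FluidPDE

/-! ### The core inequality -/

set_option maxHeartbeats 400000 in
/-- **The one-stroke cylinder inequality at fixed cut-offs** (module docstring). [folklore;
cite: KorobkovPileckasRusso2015 (Wang monograph Thm 3.5–3.6)] -/
theorem core_axialEnergy_bound : ∃ K : ℝ, 0 ≤ K ∧ ∀ (ν : ℝ), 0 < ν →
    ∀ (U : EuclideanSpace ℝ (Fin 3) → EuclideanSpace ℝ (Fin 3)) (P : EuclideanSpace ℝ (Fin 3) → ℝ),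
    IsLerayProfile ν 0 U P → ContDiff ℝ (⊤ : ℕ∞) U → ContDiff ℝ (⊤ : ℕ∞) P →
    ∀ c : ℝ, (∀ x, P x + ‖U x‖ ^ 2 / 2 ≤ c) →
    ∀ (t ε T Z : ℝ), 0 < ε → ε ≤ t → 2 * (t + ε) ≤ T → 0 ≤ Z →
    (∫⁻ x in {x : EuclideanSpace ℝ (Fin 3) | x 0 ^ 2 + x 1 ^ 2 ≤ t ^ 2 ∧ |x 2| ≤ Z},
        ENNReal.ofReal (U x 2 ^ 2)) ≤
      ENNReal.ofReal K *
          (∫⁻ x in {x : EuclideanSpace ℝ (Fin 3) | t ^ 2 < x 0 ^ 2 + x 1 ^ 2 ∧ x 0 ^ 2 + x 1 ^ 2 ≤ (t + ε) ^ 2},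
            ENNReal.ofReal (c - P x)) +
        ENNReal.ofReal ((t + ε) ^ 2) *
          (∫⁻ x in {x : EuclideanSpace ℝ (Fin 3) | (t + ε) ^ 2 < x 0 ^ 2 + x 1 ^ 2 ∧ x 0 ^ 2 + x 1 ^ 2 ≤ T ^ 2},
            ENNReal.ofReal ((x 0 * U x 1 - x 1 * U x 0) ^ 2 / (x 0 ^ 2 + x 1 ^ 2) ^ 2)) +
        ENNReal.ofReal (K * (t + ε) ^ 2) *
          (∫⁻ x in {x : EuclideanSpace ℝ (Fin 3) | T ^ 2 < x 0 ^ 2 + x 1 ^ 2 ∧ x 0 ^ 2 + x 1 ^ 2 ≤ 4 * T ^ 2},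
            ENNReal.ofReal ((x 0 * U x 1 - x 1 * U x 0) ^ 2 / (x 0 ^ 2 + x 1 ^ 2) ^ 2)) +
        ENNReal.ofReal (K * (t + ε) ^ 2 / T ^ 2) *
          (∫⁻ x in {x : EuclideanSpace ℝ (Fin 3) | T ^ 2 < x 0 ^ 2 + x 1 ^ 2 ∧ x 0 ^ 2 + x 1 ^ 2 ≤ 4 * T ^ 2},
            ENNReal.ofReal (c - P x)) +
        ENNReal.ofReal (K * (T ^ 2 + T)) *
          (∫⁻ x in {x : EuclideanSpace ℝ (Fin 3) | x 0 ^ 2 + x 1 ^ 2 ≤ 4 * T ^ 2 ∧ Z ≤ |x 2|},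
            ENNReal.ofReal (c - P x)) := by
  obtain ⟨A, hA0, hprofile⟩ := exists_radialProfile
  obtain ⟨D, hD0, hcut⟩ := exists_zCutoff
  refine ⟨6 * A + 3 * D * A + 32 * D + 1, by positivity, ?_⟩
  intro ν hν U P hprof hU hP c hQ t ε T Z hε hεt hT hZ
  set K : ℝ := 6 * A + 3 * D * A + 32 * D + 1 with hK
  have hDA : 0 ≤ D * A := mul_nonneg hD0 hA0
  have hK0 : 0 ≤ K := by positivity
  have ht : 0 < t := lt_of_lt_of_le hε hεt
  have hT0 : 0 < T := by linarith
  set c₁ : ℝ := (t + ε) ^ 2 with hc₁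
  have hc₁0 : 0 < c₁ := by positivity
  have htc : t ^ 2 < c₁ := by rw [hc₁]; nlinarith
  have hcT : c₁ ≤ T ^ 2 := by rw [hc₁]; nlinarith
  -- ### the cut-offs and the three packages
  obtain ⟨χ, hχC, hχc, hχ1, hχ0, hχ01, hχ', hχ''⟩ := hcut Z hZ
  obtain ⟨N, M, hNC, hMC, hMN, hN1, hN'1, hNcl, hN4T, hN04, hN'np, hNtr, hNtp, hMb⟩ :=
    hprofile t ε T ht hε hεt hT
  -- name the integrands
  obtain ⟨f₁, hf₁⟩ : ∃ f₁ : EuclideanSpace ℝ (Fin 3) → ℝ, f₁ = (fun x : EuclideanSpace ℝ (Fin 3) => (P x - c) *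
    (χ (x 2) * (2 * N (x 0 ^ 2 + x 1 ^ 2) + 2 * (x 0 ^ 2 + x 1 ^ 2) * deriv N (x 0 ^ 2 + x 1 ^ 2)) +
      deriv (deriv χ) (x 2) * M (x 0 ^ 2 + x 1 ^ 2))) := ⟨_, rfl⟩
  obtain ⟨f₂, hf₂⟩ : ∃ f₂ : EuclideanSpace ℝ (Fin 3) → ℝ, f₂ = (fun x : EuclideanSpace ℝ (Fin 3) =>
    χ (x 2) * (N (x 0 ^ 2 + x 1 ^ 2) * (U x 0 ^ 2 + U x 1 ^ 2) +
        2 * deriv N (x 0 ^ 2 + x 1 ^ 2) * (x 0 * U x 0 + x 1 * U x 1) ^ 2) +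
      2 * deriv χ (x 2) * N (x 0 ^ 2 + x 1 ^ 2) * ((x 0 * U x 0 + x 1 * U x 1) * U x 2) +
      deriv (deriv χ) (x 2) * M (x 0 ^ 2 + x 1 ^ 2) * U x 2 ^ 2) := ⟨_, rfl⟩
  obtain ⟨E, hE⟩ : ∃ E : EuclideanSpace ℝ (Fin 3) → ℝ, E = (fun x : EuclideanSpace ℝ (Fin 3) =>
    deriv (deriv χ) (x 2) * M (x 0 ^ 2 + x 1 ^ 2) * (P x - c) +
      2 * deriv χ (x 2) * N (x 0 ^ 2 + x 1 ^ 2) * ((x 0 * U x 0 + x 1 * U x 1) * U x 2) +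
      deriv (deriv χ) (x 2) * M (x 0 ^ 2 + x 1 ^ 2) * U x 2 ^ 2) := ⟨_, rfl⟩
  obtain ⟨W, hW⟩ : ∃ W : EuclideanSpace ℝ (Fin 3) → ℝ, W = (fun x : EuclideanSpace ℝ (Fin 3) =>
    2 * (N (x 0 ^ 2 + x 1 ^ 2) + (x 0 ^ 2 + x 1 ^ 2) * deriv N (x 0 ^ 2 + x 1 ^ 2)) *
        (P x - c + (U x 0 ^ 2 + U x 1 ^ 2 + U x 2 ^ 2) / 2) +
      deriv N (x 0 ^ 2 + x 1 ^ 2) * ((x 0 * U x 0 + x 1 * U x 1) ^ 2 - (x 0 * U x 1 - x 1 * U x 0) ^ 2) -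
      (N (x 0 ^ 2 + x 1 ^ 2) + (x 0 ^ 2 + x 1 ^ 2) * deriv N (x 0 ^ 2 + x 1 ^ 2)) * U x 2 ^ 2) := ⟨_, rfl⟩
  have hK6 : 6 * A ≤ K := by rw [hK]; linarith
  have hK4 : 4 * A ≤ K := by rw [hK]; linarith
  have hKA : A ≤ K := by rw [hK]; linarith
  obtain ⟨hf₁i, hf₂i, hid⟩ := core_identity hprof hU hP c (T := T) hχC hχ0 hNC hMC hMN hN4T f₁ f₂ hf₁ hf₂
  have hK1' : 3 * D * (A * T ^ 2) + 32 * D * T ≤ K * (T ^ 2 + T) := by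
    have h1 : 3 * D * A ≤ K := by rw [hK]; linarith
    have h2 : 32 * D ≤ K := by rw [hK]; linarith
    have hT2 : 0 ≤ T ^ 2 := sq_nonneg T
    nlinarith [mul_le_mul_of_nonneg_right h1 hT2, mul_le_mul_of_nonneg_right h2 hT0.le]
  obtain ⟨hEc, hEi, hE0, hEabs⟩ := core_error hU hP hQ hT0 hχC hχ1 hχ0 hχ' hχ'' hNC hMC hN4T hN04 hMb hK1' E hE
  obtain ⟨hWcore, hWtrans, hWclean, hWtaper, hWfar⟩ := core_zone_bounds (U := U) (P := P) (c := c) hQ hNC hcT htc hT0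
    hN1 hN'1 hNcl (fun s hs => ⟨(hN4T s hs).1, (hN4T s hs).2.1, rfl⟩) hN'np hNtr hNtp
    hK6 hK4 hKA W hW
  set F : EuclideanSpace ℝ (Fin 3) → ℝ := fun x => f₁ x + f₂ x with hF
  have hFi : Integrable F := hf₁i.add hf₂i
  have hF0 : ∫ x, F x = 0 := by rw [hF]; simp only []; rw [integral_add hf₁i hf₂i]; exact hid
  have hFWE : ∀ x, F x = χ (x 2) * W x + E x := fun x => by
    simp only [hF, hf₁, hf₂, hW, hE]; ring
  -- coordinates are continuous
  have hco : ∀ i : Fin 3, Continuous fun y : EuclideanSpace ℝ (Fin 3) => y i := fun i =>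
    (EuclideanSpace.proj (𝕜 := ℝ) i).continuous
  have hsC : Continuous fun y : EuclideanSpace ℝ (Fin 3) => y 0 ^ 2 + y 1 ^ 2 := ((hco 0).pow 2).add ((hco 1).pow 2)
  have hUc : ∀ i : Fin 3, Continuous fun y : EuclideanSpace ℝ (Fin 3) => U y i := fun i =>
    (hco i).comp hU.continuous
  have hPc : Continuous P := hP.continuous
  -- ### the zones and the bound functions
  have hsm : Measurable fun x : EuclideanSpace ℝ (Fin 3) => x 0 ^ 2 + x 1 ^ 2 := hsC.measurable
  have ham : Measurable fun x : EuclideanSpace ℝ (Fin 3) => |x 2| := (continuous_abs.comp (hco 2)).measurable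
  set S₀ : Set (EuclideanSpace ℝ (Fin 3)) := {x | x 0 ^ 2 + x 1 ^ 2 ≤ t ^ 2 ∧ |x 2| ≤ Z} with hS₀
  set Z₁ : Set (EuclideanSpace ℝ (Fin 3)) := {x | x 0 ^ 2 + x 1 ^ 2 ≤ t ^ 2} with hZ₁
  set Z₂ : Set (EuclideanSpace ℝ (Fin 3)) := {x | t ^ 2 < x 0 ^ 2 + x 1 ^ 2 ∧ x 0 ^ 2 + x 1 ^ 2 ≤ (t + ε) ^ 2} with hZ₂
  set Z₃ : Set (EuclideanSpace ℝ (Fin 3)) := {x | (t + ε) ^ 2 < x 0 ^ 2 + x 1 ^ 2 ∧ x 0 ^ 2 + x 1 ^ 2 ≤ T ^ 2} with hZ₃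
  set Z₄ : Set (EuclideanSpace ℝ (Fin 3)) := {x | T ^ 2 < x 0 ^ 2 + x 1 ^ 2 ∧ x 0 ^ 2 + x 1 ^ 2 ≤ 4 * T ^ 2} with hZ₄
  have hS₀m : MeasurableSet S₀ := (measurableSet_le hsm measurable_const).inter (measurableSet_le ham measurable_const)
  have hZ₁m : MeasurableSet Z₁ := measurableSet_le hsm measurable_const
  have hZ₂m : MeasurableSet Z₂ := (measurableSet_lt measurable_const hsm).inter (measurableSet_le hsm measurable_const)
  have hZ₃m : MeasurableSet Z₃ := (measurableSet_lt measurable_const hsm).inter (measurableSet_le hsm measurable_const)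
  have hZ₄m : MeasurableSet Z₄ := (measurableSet_lt measurable_const hsm).inter (measurableSet_le hsm measurable_const)
  set Γs : EuclideanSpace ℝ (Fin 3) → ℝ := fun x => (x 0 * U x 1 - x 1 * U x 0) ^ 2 / (x 0 ^ 2 + x 1 ^ 2) ^ 2 with hΓs
  set B₂ : EuclideanSpace ℝ (Fin 3) → ℝ := fun x => χ (x 2) * (K * (c - P x)) with hB₂
  set B₃ : EuclideanSpace ℝ (Fin 3) → ℝ := fun x => χ (x 2) * (c₁ * Γs x) with hB₃
  set B₄ : EuclideanSpace ℝ (Fin 3) → ℝ := fun x => χ (x 2) * (K * c₁ / T ^ 2 * (c - P x) + K * c₁ * Γs x) with hB₄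
  -- continuity of `Γs` away from the axis
  have hΓnum : Continuous fun x : EuclideanSpace ℝ (Fin 3) => (x 0 * U x 1 - x 1 * U x 0) ^ 2 :=
    (((hco 0).mul (hUc 1)).sub ((hco 1).mul (hUc 0))).pow 2
  have hΓs_cont : ∀ {S : Set (EuclideanSpace ℝ (Fin 3))}, (∀ x ∈ S, 0 < x 0 ^ 2 + x 1 ^ 2) → ContinuousOn Γs S :=
    fun {S} hS => by
    rw [hΓs]
    exact hΓnum.continuousOn.div (hsC.pow 2).continuousOn fun x hx => (pow_pos (hS x hx) 2).ne'
  have hΓs0 : ∀ x, 0 ≤ Γs x := fun x => by rw [hΓs]; positivity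
  -- integrability of the bound functions on their zones
  have hχc0 : Continuous fun x : EuclideanSpace ℝ (Fin 3) => χ (x 2) := hχC.continuous.comp (hco 2)
  have hB₂i : IntegrableOn B₂ Z₂ volume := by
    refine integrableOn_of_continuousOn_compact_vanish (isCompact_solidCylinder ((t + ε) ^ 2) (Z + 1)) hZ₂m
      ((hχc0.mul ((continuous_const.sub hPc).const_mul K)).continuousOn) fun x hx => ?_
    obtain ⟨hx2, hxK⟩ := hx
    have : Z + 1 < |x 2| := by
      simp only [mem_setOf_eq, not_and_or, not_le] at hxK
      rcases hxK with h | h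
      · exact absurd hx2.2 (not_le.2 h)
      · exact h
    simp only [hB₂, hχ0 _ this.le]; ring
  have hB₃i : IntegrableOn B₃ Z₃ volume := by
    have hKc : IsCompact ({x : EuclideanSpace ℝ (Fin 3) | x 0 ^ 2 + x 1 ^ 2 ≤ T ^ 2 ∧ |x 2| ≤ Z + 1} ∩
        {x | (t + ε) ^ 2 ≤ x 0 ^ 2 + x 1 ^ 2}) :=
      (isCompact_solidCylinder _ _).inter_right (isClosed_le continuous_const hsC)
    refine integrableOn_of_continuousOn_compact_vanish hKc hZ₃m
      (hχc0.continuousOn.mul (continuousOn_const.mul (hΓs_cont fun x hx => hc₁0.trans_le hx.2))) fun x hx => ?_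
    obtain ⟨hx3, hxK⟩ := hx
    have : Z + 1 < |x 2| := by
      simp only [mem_inter_iff, mem_setOf_eq, not_and_or, not_le] at hxK
      rcases hxK with (h | h) | h
      · exact absurd hx3.2 (not_le.2 h)
      · exact h
      · exact absurd hx3.1.le (not_le.2 h)
    simp only [hB₃, hχ0 _ this.le]; ring
  have hB₄i : IntegrableOn B₄ Z₄ volume := by
    have hKc : IsCompact ({x : EuclideanSpace ℝ (Fin 3) | x 0 ^ 2 + x 1 ^ 2 ≤ 4 * T ^ 2 ∧ |x 2| ≤ Z + 1} ∩
        {x | T ^ 2 ≤ x 0 ^ 2 + x 1 ^ 2}) :=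
      (isCompact_solidCylinder _ _).inter_right (isClosed_le continuous_const hsC)
    have hT2 : (0 : ℝ) < T ^ 2 := by positivity
    refine integrableOn_of_continuousOn_compact_vanish hKc hZ₄m
      (hχc0.continuousOn.mul ((((continuous_const.sub hPc).const_mul (K * c₁ / T ^ 2)).continuousOn).add
        (continuousOn_const.mul (hΓs_cont fun x hx => hT2.trans_le hx.2)))) fun x hx => ?_
    obtain ⟨hx4, hxK⟩ := hx
    have : Z + 1 < |x 2| := by
      simp only [mem_inter_iff, mem_setOf_eq, not_and_or, not_le] at hxK
      rcases hxK with (h | h) | h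
      · exact absurd hx4.2 (not_le.2 h)
      · exact h
      · exact absurd hx4.1.le (not_le.2 h)
    simp only [hB₄, hχ0 _ this.le]; ring
  -- ### the real-variable inequality
  have hQle : ∀ x, P x - c + (U x 0 ^ 2 + U x 1 ^ 2 + U x 2 ^ 2) / 2 ≤ 0 := fun x => by
    have h := hQ x
    have hn : ‖U x‖ ^ 2 = U x 0 ^ 2 + U x 1 ^ 2 + U x 2 ^ 2 := by
      rw [EuclideanSpace.norm_sq_eq, Fin.sum_univ_three]; simp [Real.norm_eq_abs, sq_abs]
    rw [hn] at h; linarith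
  have hgi : IntegrableOn (fun x : EuclideanSpace ℝ (Fin 3) => U x 2 ^ 2) S₀ volume :=
    ((hUc 2).pow 2).continuousOn.integrableOn_compact (isCompact_solidCylinder (t ^ 2) Z)
  have hreal : ∫ x in S₀, U x 2 ^ 2 ≤ (∫ x in Z₂, B₂ x) + (∫ x in Z₃, B₃ x) + (∫ x in Z₄, B₄ x) + ∫ x, E x := by
    refine setIntegral_le_of_zones hFi hEi hF0 hS₀m hZ₁m hZ₂m hZ₃m hZ₄m (fun x hx => hx.1)
      (fun x hx => not_le.2 hx.1) (fun x hx => not_le.2 (htc.trans hx.1))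
      (fun x hx => not_le.2 ((htc.trans_le hcT).trans hx.1)) hgi ?_ ?_ hB₂i hB₃i hB₄i ?_
    · -- on `S₀`: `u_z² ≤ E − F`
      intro x hx
      have hWx := hWcore x hx.1
      rw [hFWE x, hχ1 _ hx.2, hWx]
      nlinarith [hQle x]
    · -- on `Z₁`: `0 ≤ E − F`
      intro x hx
      have hWx := hWcore x hx
      rw [hFWE x, hWx]
      nlinarith [hQle x, (hχ01 (x 2)).1, sq_nonneg (U x 2)]
    · -- off `Z₁`: the zone bounds
      intro x hx
      have hx' : t ^ 2 < x 0 ^ 2 + x 1 ^ 2 := not_le.1 hx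
      have hχx := (hχ01 (x 2)).1
      rw [hFWE x, add_sub_cancel_right]
      by_cases h2 : x 0 ^ 2 + x 1 ^ 2 ≤ (t + ε) ^ 2
      · have hm2 : x ∈ Z₂ := ⟨hx', h2⟩
        have hm3 : x ∉ Z₃ := fun h => absurd h.1 (not_lt.2 h2)
        have hm4 : x ∉ Z₄ := fun h => absurd (hcT.trans_lt h.1) (not_lt.2 h2)
        rw [indicator_of_mem hm2, indicator_of_notMem hm3, indicator_of_notMem hm4, add_zero, add_zero, hB₂]
        exact mul_le_mul_of_nonneg_left (hWtrans x hx' h2) hχx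
      by_cases h3 : x 0 ^ 2 + x 1 ^ 2 ≤ T ^ 2
      · have hm2 : x ∉ Z₂ := fun h => h2 h.2
        have hm3 : x ∈ Z₃ := ⟨not_le.1 h2, h3⟩
        have hm4 : x ∉ Z₄ := fun h => absurd h.1 (not_lt.2 h3)
        rw [indicator_of_notMem hm2, indicator_of_mem hm3, indicator_of_notMem hm4, zero_add, add_zero, hB₃]
        exact mul_le_mul_of_nonneg_left (hWclean x (not_le.1 h2) h3) hχx
      by_cases h4 : x 0 ^ 2 + x 1 ^ 2 ≤ 4 * T ^ 2
      · have hm2 : x ∉ Z₂ := fun h => h2 h.2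
        have hm3 : x ∉ Z₃ := fun h => h3 h.2
        have hm4 : x ∈ Z₄ := ⟨not_le.1 h3, h4⟩
        rw [indicator_of_notMem hm2, indicator_of_notMem hm3, indicator_of_mem hm4, zero_add, zero_add, hB₄]
        exact mul_le_mul_of_nonneg_left (hWtaper x (not_le.1 h3) h4) hχx
      · have hm2 : x ∉ Z₂ := fun h => h2 h.2
        have hm3 : x ∉ Z₃ := fun h => h3 h.2
        have hm4 : x ∉ Z₄ := fun h => h4 h.2
        rw [indicator_of_notMem hm2, indicator_of_notMem hm3, indicator_of_notMem hm4, add_zero, add_zero,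
          hWfar x (not_le.1 h4), mul_zero]
  -- ### the cut-off error
  set R' : Set (EuclideanSpace ℝ (Fin 3)) := {x | x 0 ^ 2 + x 1 ^ 2 ≤ 4 * T ^ 2 ∧ |x 2| ≤ Z + 1} ∩ {x | Z ≤ |x 2|}
    with hR'
  have hR'm : MeasurableSet R' :=
    ((measurableSet_le hsm measurable_const).inter (measurableSet_le ham measurable_const)).inter
      (measurableSet_le measurable_const ham)
  have hR'c : IsCompact R' := (isCompact_solidCylinder _ _).inter_right (isClosed_le continuous_const (continuous_abs.comp (hco 2)))
  have hpi : IntegrableOn (fun x => c - P x) R' volume := (continuous_const.sub hPc).continuousOn.integrableOn_compact hR'c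
  have hEint : ∫ x, E x ≤ K * (T ^ 2 + T) * ∫ x in R', (c - P x) :=
    integral_le_of_abs_le_on hR'm hEi hpi (fun x hx => hE0 x fun h => hx ⟨⟨h.1, h.2.2⟩, h.2.1⟩)
      (fun x hx => hEabs x hx.1.1)
  -- ### conversion to `ℝ≥0∞`
  have hcP : ∀ x, 0 ≤ c - P x := fun x => by
    nlinarith [hQle x, sq_nonneg (U x 0), sq_nonneg (U x 1), sq_nonneg (U x 2)]
  have hχle1 : ∀ x : EuclideanSpace ℝ (Fin 3), χ (x 2) ≤ 1 := fun x => (hχ01 _).2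
  have hχ0le : ∀ x : EuclideanSpace ℝ (Fin 3), 0 ≤ χ (x 2) := fun x => (hχ01 _).1
  -- generic step: `ofReal (∫_S χ·g) ≤ ofReal a * ∫⁻_S ofReal g₀` when `0 ≤ χ g ≤ a g₀`
  have hconv : ∀ {S : Set (EuclideanSpace ℝ (Fin 3))} {f g : EuclideanSpace ℝ (Fin 3) → ℝ} {a : ℝ},
      0 ≤ a → IntegrableOn f S volume → (∀ x, 0 ≤ f x) → (∀ x, f x ≤ a * g x) →
      ENNReal.ofReal (∫ x in S, f x) ≤ ENNReal.ofReal a * ∫⁻ x in S, ENNReal.ofReal (g x) := by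
    intro S f g a ha hfi hf0 hfg
    rw [ofReal_integral_eq_lintegral_ofReal hfi (ae_of_all _ hf0),
      ← lintegral_const_mul' _ _ ENNReal.ofReal_ne_top]
    refine lintegral_mono fun x => ?_
    rw [← ENNReal.ofReal_mul ha]
    exact ENNReal.ofReal_le_ofReal (hfg x)
  -- the four main terms
  have hT2 : ENNReal.ofReal (∫ x in Z₂, B₂ x) ≤
      ENNReal.ofReal K * ∫⁻ x in Z₂, ENNReal.ofReal (c - P x) :=
    hconv hK0 hB₂i (fun x => by simp only [hB₂]; exact mul_nonneg (hχ0le x) (mul_nonneg hK0 (hcP x)))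
      (fun x => by
        simp only [hB₂]
        nlinarith [hχle1 x, hχ0le x, mul_nonneg hK0 (hcP x)])
  have hT3 : ENNReal.ofReal (∫ x in Z₃, B₃ x) ≤ ENNReal.ofReal c₁ * ∫⁻ x in Z₃, ENNReal.ofReal (Γs x) :=
    hconv hc₁0.le hB₃i (fun x => by simp only [hB₃]; exact mul_nonneg (hχ0le x) (mul_nonneg hc₁0.le (hΓs0 x)))
      (fun x => by
        simp only [hB₃]
        nlinarith [hχle1 x, hχ0le x, mul_nonneg hc₁0.le (hΓs0 x)])
  have hKc : 0 ≤ K * c₁ / T ^ 2 := by positivity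
  have hKc' : 0 ≤ K * c₁ := by positivity
  have hT4 : ENNReal.ofReal (∫ x in Z₄, B₄ x) ≤
      ENNReal.ofReal (K * c₁) * (∫⁻ x in Z₄, ENNReal.ofReal (Γs x)) +
        ENNReal.ofReal (K * c₁ / T ^ 2) * ∫⁻ x in Z₄, ENNReal.ofReal (c - P x) := by
    have h1 : ENNReal.ofReal (∫ x in Z₄, B₄ x) ≤
        ENNReal.ofReal 1 * ∫⁻ x in Z₄, ENNReal.ofReal (K * c₁ / T ^ 2 * (c - P x) + K * c₁ * Γs x) :=
      hconv zero_le_one hB₄i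
        (fun x => by simp only [hB₄]; exact mul_nonneg (hχ0le x) (add_nonneg (mul_nonneg hKc (hcP x)) (mul_nonneg hKc' (hΓs0 x))))
        (fun x => by
          simp only [hB₄]
          nlinarith [hχle1 x, hχ0le x, mul_nonneg hKc (hcP x), mul_nonneg hKc' (hΓs0 x)])
    rw [ENNReal.ofReal_one, one_mul] at h1
    refine h1.trans ?_
    have hmeas : Measurable fun x : EuclideanSpace ℝ (Fin 3) => ENNReal.ofReal (K * c₁ / T ^ 2 * (c - P x)) :=
      ENNReal.measurable_ofReal.comp (((continuous_const.sub hPc).const_mul _).measurable)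
    have hsplit : ∀ x : EuclideanSpace ℝ (Fin 3), ENNReal.ofReal (K * c₁ / T ^ 2 * (c - P x) + K * c₁ * Γs x) =
        ENNReal.ofReal (K * c₁ / T ^ 2 * (c - P x)) + ENNReal.ofReal (K * c₁ * Γs x) := fun x =>
      ENNReal.ofReal_add (mul_nonneg hKc (hcP x)) (mul_nonneg hKc' (hΓs0 x))
    simp_rw [hsplit]
    rw [lintegral_add_left hmeas]
    simp_rw [ENNReal.ofReal_mul hKc, ENNReal.ofReal_mul hKc']
    rw [lintegral_const_mul' _ _ ENNReal.ofReal_ne_top, lintegral_const_mul' _ _ ENNReal.ofReal_ne_top, add_comm]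
  -- the error term
  have hT5 : ENNReal.ofReal (∫ x, E x) ≤ ENNReal.ofReal (K * (T ^ 2 + T)) *
      ∫⁻ x in {x : EuclideanSpace ℝ (Fin 3) | x 0 ^ 2 + x 1 ^ 2 ≤ 4 * T ^ 2 ∧ Z ≤ |x 2|}, ENNReal.ofReal (c - P x) := by
    have hK2 : 0 ≤ K * (T ^ 2 + T) := by positivity
    refine (ENNReal.ofReal_le_ofReal hEint).trans ?_
    rw [ENNReal.ofReal_mul hK2, ofReal_integral_eq_lintegral_ofReal hpi (ae_of_all _ hcP)]
    have hsub : R' ⊆ {x : EuclideanSpace ℝ (Fin 3) | x 0 ^ 2 + x 1 ^ 2 ≤ 4 * T ^ 2 ∧ Z ≤ |x 2|} :=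
      fun x hx => ⟨hx.1.1, hx.2⟩
    have hmono := lintegral_mono_set (μ := volume) (f := fun x => ENNReal.ofReal (c - P x)) hsub
    gcongr
  -- assemble
  have hL : (∫⁻ x in S₀, ENNReal.ofReal (U x 2 ^ 2)) = ENNReal.ofReal (∫ x in S₀, U x 2 ^ 2) :=
    (ofReal_integral_eq_lintegral_ofReal hgi (ae_of_all _ fun x => sq_nonneg _)).symm
  rw [hL]
  refine (ENNReal.ofReal_le_ofReal hreal).trans ?_
  refine (ENNReal.ofReal_add_le).trans ?_
  refine (add_le_add (ENNReal.ofReal_add_le) le_rfl).trans ?_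
  refine (add_le_add (add_le_add (ENNReal.ofReal_add_le) le_rfl) le_rfl).trans ?_
  calc ENNReal.ofReal (∫ x in Z₂, B₂ x) + ENNReal.ofReal (∫ x in Z₃, B₃ x) + ENNReal.ofReal (∫ x in Z₄, B₄ x) +
        ENNReal.ofReal (∫ x, E x)
      ≤ ENNReal.ofReal K * (∫⁻ x in Z₂, ENNReal.ofReal (c - P x)) +
          ENNReal.ofReal c₁ * (∫⁻ x in Z₃, ENNReal.ofReal (Γs x)) +
          (ENNReal.ofReal (K * c₁) * (∫⁻ x in Z₄, ENNReal.ofReal (Γs x)) +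
            ENNReal.ofReal (K * c₁ / T ^ 2) * ∫⁻ x in Z₄, ENNReal.ofReal (c - P x)) +
          ENNReal.ofReal (K * (T ^ 2 + T)) *
            ∫⁻ x in {x : EuclideanSpace ℝ (Fin 3) | x 0 ^ 2 + x 1 ^ 2 ≤ 4 * T ^ 2 ∧ Z ≤ |x 2|}, ENNReal.ofReal (c - P x) :=
        add_le_add (add_le_add (add_le_add hT2 hT3) hT4) hT5
    _ = _ := by simp only [hΓs]; ring

end Summit.NavierStokesRegularity.NavierStokesRegularity.Theorems.GaldiLiouville.AllAxesBudget

end
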